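import Summits.QuantumFields.YangMills.Theorems.VirialFluxGapCentralCoercivity
import Summits.QuantumFields.YangMills.Theorems.VirialFluxGapFixCentralChart
import HarnessLib

/-!
# Route `VirialFluxGap` (YangMills): the central chart of `X_fix` BASED AT THE CENTRAL PROJECTION — logarithmic coordinates `u` of `P` relative to
# `π_C P` with `|u|² ≤ C·L⁸·F₀(P)` (central coercivity, part III; free-hands helper toward crux ⟨stmt-QuantumFields-24141⟩ `PeriodicSoftness`)

Width seat `ym-line-sfw-p2-w3` g59 (cell ym-idea-1, free hands; own crux ⟨22884⟩ has no free stub), `--supports stmt-QuantumFields-24141`.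

w2 g51's ✓`FixFrame.exists_fixCentralChart_of_central` writes a `ρ`-central `X_fix` point as `P = c_{s,b}·exp(dirOf fixFrameStd u)` from the central
comb POINT `c_{s,b}`, with `|u|² ≤ 48·(6L⁴(4L√F₀+12L²√F₀+4ρ)² + L³(12L²√F₀+4ρ)²)` — an additive `ρ` (the zero-mode displacement).  The central field
`X_c = X_z + Π_⊥A⁻¹Π_⊥(∇F − ∇F∘π_C)` of LEAD note №4 is based at the central PROJECTION `π_C P` instead, and there the transverse coordinate is
controlled by the deficit ALONE (✓`CentralCoercivity.norm_sq_slice_sub_centralProj_le` ∕ `…seam…`, exponent one):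

* `sign_of_central` — a `ρ`-central slot (`1 − Re² ≤ ¾`) lies on the hemisphere of `σ := sign Re` with `σ·Re ≥ ½` (the sign hypotheses of part II);
* ★ `fd_slice_centralProj_le` ∕ `fd_seam_centralProj_le` — per slot `fd ≤ 192L²·√F₀(P)` ∕ `144L²·√F₀(P)` between `P` and `π_C P`;
* ★★★ `exists_fixChart_centralProj` — if the slice-`0` tree links of `P` are `1`, the shadow data lie on the hemispheres of `σ, σ₄` (`σ_k·Re q(w_k) ≥ ½`,
  `σ₄·Re q(P.2 0) ≥ ½`) and `192L²·√F₀(P) < ¼`, then `P = π_C P · multiCurve (dirOf fixFrameStd u) 1` with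
  `u ⬝ᵥ u ≤ 11612160·L⁸·F₀(P)` (`= 192 · 60480`; fcl-p3's ✓`exists_multiCurve_eq_of_near` from the base `π_C P`, whose slice-`0` tree links are `1` too;
  ✓`dirOf_fixFrameStd_fixCoord`, ✓`fixCoord_dot_self_le`).

So on the central region the pair `(z(P), u(P))` of LEAD notes №4–№6 satisfies `|u|² ≤ C·L⁸·F₀(P)` and (part II-b) `Q(z) = F₀(π_C P) ≤ C′·L⁶·F₀(P)`:
the polynomial central coercivity `F₀(P) ≥ poly(L)⁻¹·(|u|² + Q(z))`.

HONEST LABEL: chart bookkeeping (zero ℏ) for a RECORD-label crux of a DRAFT route; the central field, (E1)/(E2) on the central chart and the patching are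
NOT here; ⟨24141⟩ and ⟨22884⟩ stay OPEN; no stub ∕ crux ∕ rung ∕ summit is closed; the Yang–Mills mass gap is NOT proved by this; no summit is proved by a
line.  THEOREMS ONLY (no `def`, no `sorry`).

References: M. Lüscher, Nucl. Phys. B 219 (1983) 233–261, §2 [Luscher1983]; A. Coste et al., Nucl. Phys. B 262 (1985) 67–94 [CosteEtAl1985].
-/

set_option autoImplicit false

noncomputable section

open scoped Quaternion Matrix BigOperators
open Literature.MathematicalPhysics.QuantumFieldTheory hiding SU2
open Literature.MathematicalPhysics.QuantumLattice

namespace Summit.QuantumFields.YangMills.Theorems.VirialFluxGap.CentralCoercivity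

open Summit.QuantumFields.YangMills.Theorems.FemtoTransferGap
open Summit.QuantumFields.YangMills.Theorems.FemtoTransferGap.TT
open Summit.QuantumFields.YangMills.Theorems.FemtoTransferGap.TwoLattice
open Summit.QuantumFields.YangMills.Theorems.FemtoTransferGap.TwoLattice.Flat
open Summit.QuantumFields.YangMills.Theorems.VirialFluxGap.RingDeficit
open Summit.QuantumFields.YangMills.Theorems.VirialFluxGap.FrameDerivative
open Summit.QuantumFields.YangMills.Theorems.VirialFluxGap.FrameHessian
open Summit.QuantumFields.YangMills.Theorems.VirialFluxGap.RegularValley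
open Summit.QuantumFields.YangMills.Theorems.VirialFluxGap.FixFrame
open Summit.QuantumFields.YangMills.Theorems.ToronValleyVolume.Lojasiewicz

open scoped Matrix.Norms.Frobenius

variable {L : ℕ} [NeZero L]

/-! ## §1 Signs on the central region -/

omit [NeZero L] in
/-- A `ρ`-central slot with `ρ² ≤ ¾` lies on the hemisphere of the sign of its real part, at height `≥ ½`: there is `σ = ±1` with `σ·Re q(U) ≥ ½`.
[folklore] -/
theorem sign_of_central (U : SU2) (h : 1 - (su2Quat U).re ^ 2 ≤ 3 / 4) :
    ∃ σ : ℝ, (σ = 1 ∨ σ = -1) ∧ (1 / 2 : ℝ) ≤ σ * (su2Quat U).re := by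
  have hsq : (1 / 4 : ℝ) ≤ (su2Quat U).re ^ 2 := by linarith
  by_cases hre : 0 ≤ (su2Quat U).re
  · refine ⟨1, Or.inl rfl, ?_⟩
    rw [one_mul]
    by_contra hlt
    have hlt' : (su2Quat U).re < 1 / 2 := lt_of_not_ge hlt
    nlinarith [mul_lt_mul'' hlt' hlt' hre hre]
  · refine ⟨-1, Or.inr rfl, ?_⟩
    have hre' : 0 ≤ -(su2Quat U).re := by linarith
    rw [neg_one_mul]
    by_contra hlt
    have hlt' : -(su2Quat U).re < 1 / 2 := lt_of_not_ge hlt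
    nlinarith [mul_lt_mul'' hlt' hlt' hre' hre']

/-! ## §2 Per-slot Frobenius distances to `π_C P` -/

omit [NeZero L] in
/-- From a squared bound to a bound: `x² ≤ (c·y)²`-type extraction with `c, y ≥ 0`. [folklore] -/
theorem le_of_sq_le_sq_mul {x c F : ℝ} (hx : 0 ≤ x) (hc : 0 ≤ c) (hF : 0 ≤ F) (h : x ^ 2 ≤ c ^ 2 * F) : x ≤ c * Real.sqrt F := by
  have hF2 : Real.sqrt F ^ 2 = F := Real.sq_sqrt hF
  have h' : x ^ 2 ≤ (c * Real.sqrt F) ^ 2 := by rw [mul_pow, hF2]; exact h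
  exact (pow_le_pow_iff_left₀ hx (by positivity) two_ne_zero).1 h'

/-- ★ **Per-link Frobenius distance to the central projection**: `fd (P.1 i e) ((π_C P).1 i e) ≤ 192L²·√F₀(P)` on the central region.
[cite: CosteEtAl1985] -/
theorem fd_slice_centralProj_le (P : (Fin (2 * L - 1 + 1) → GaugeConfig 3 L SU2) × (Site 3 L → SU2))
    (ht : treeGauge (P.1 0) = 1) {σ : Fin 3 → ℝ} (hσ : ∀ k, σ k = 1 ∨ σ k = -1) (σ₄ : ℝ)
    (hW : ∀ k : Fin 3, (1 / 2 : ℝ) ≤ σ k * (su2Quat (wrapReps (P.1 0) k)).re)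
    (i : Fin (2 * L - 1 + 1)) (e : Edge 3 L) :
    fd (P.1 i e) ((centralProj L σ σ₄ P).1 i e) ≤ 192 * (L : ℝ) ^ 2 * Real.sqrt (ringDeficit L (fun _ => false) P) := by
  have hF0 : 0 ≤ ringDeficit L (fun _ => false) P := ringDeficit_nonneg _ P
  have h1 := norm_sq_slice_sub_centralProj_le P ht hσ σ₄ hW i e
  have h2 : ‖su2Quat (P.1 i e) - su2Quat ((centralProj L σ σ₄ P).1 i e)‖ ≤ 96 * (L : ℝ) ^ 2 * Real.sqrt (ringDeficit L (fun _ => false) P) :=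
    le_of_sq_le_sq_mul (norm_nonneg _) (by positivity) hF0 (by rw [mul_pow, ← pow_mul]; norm_num; linarith [h1])
  calc fd (P.1 i e) ((centralProj L σ σ₄ P).1 i e) ≤ 2 * ‖su2Quat (P.1 i e) - su2Quat ((centralProj L σ σ₄ P).1 i e)‖ :=
        fd_le_two_mul_norm_su2Quat_sub _ _
    _ ≤ 2 * (96 * (L : ℝ) ^ 2 * Real.sqrt (ringDeficit L (fun _ => false) P)) := by linarith
    _ = 192 * (L : ℝ) ^ 2 * Real.sqrt (ringDeficit L (fun _ => false) P) := by ring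

/-- ★ **Per-site Frobenius distance to the central projection**: `fd (P.2 x) ((π_C P).2 x) ≤ 144L²·√F₀(P)` on the central region.
[cite: CosteEtAl1985] -/
theorem fd_seam_centralProj_le (P : (Fin (2 * L - 1 + 1) → GaugeConfig 3 L SU2) × (Site 3 L → SU2))
    (ht : treeGauge (P.1 0) = 1) (σ : Fin 3 → ℝ) {σ₄ : ℝ} (hσ₄ : σ₄ = 1 ∨ σ₄ = -1)
    (hS : (1 / 2 : ℝ) ≤ σ₄ * (su2Quat (P.2 0)).re) (x : Site 3 L) :
    fd (P.2 x) ((centralProj L σ σ₄ P).2 x) ≤ 144 * (L : ℝ) ^ 2 * Real.sqrt (ringDeficit L (fun _ => false) P) := by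
  have hF0 : 0 ≤ ringDeficit L (fun _ => false) P := ringDeficit_nonneg _ P
  have h1 := norm_sq_seam_sub_centralProj_le P ht σ hσ₄ hS x
  have h2 : ‖su2Quat (P.2 x) - su2Quat ((centralProj L σ σ₄ P).2 x)‖ ≤ 72 * (L : ℝ) ^ 2 * Real.sqrt (ringDeficit L (fun _ => false) P) :=
    le_of_sq_le_sq_mul (norm_nonneg _) (by positivity) hF0 (by rw [mul_pow, ← pow_mul]; norm_num; linarith [h1])
  calc fd (P.2 x) ((centralProj L σ σ₄ P).2 x) ≤ 2 * ‖su2Quat (P.2 x) - su2Quat ((centralProj L σ σ₄ P).2 x)‖ :=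
        fd_le_two_mul_norm_su2Quat_sub _ _
    _ ≤ 2 * (72 * (L : ℝ) ^ 2 * Real.sqrt (ringDeficit L (fun _ => false) P)) := by linarith
    _ = 144 * (L : ℝ) ^ 2 * Real.sqrt (ringDeficit L (fun _ => false) P) := by ring

/-! ## §3 The chart based at `π_C P` -/

/-- ★★★ **The central chart of `X_fix` based at the central projection.**  If the slice-`0` tree links of `P` are `1`, the shadow data lie on the
hemispheres of the signs `σ, σ₄` at height `≥ ½`, and `192L²·√F₀(P) < ¼`, then `P = π_C P · exp(dirOf fixFrameStd u)` with
`u ⬝ᵥ u ≤ 11612160·L⁸·F₀(P)` — the transverse coordinate of LEAD notes №4–№6 is `O(L⁴√F₀)`, with NO zero-mode term. [cite: CosteEtAl1985] -/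
theorem exists_fixChart_centralProj (P : (Fin (2 * L - 1 + 1) → GaugeConfig 3 L SU2) × (Site 3 L → SU2))
    (hP : ∀ e : Edge 3 L, treeEdge e = true → P.1 0 e = 1) {σ : Fin 3 → ℝ} (hσ : ∀ k, σ k = 1 ∨ σ k = -1) {σ₄ : ℝ} (hσ₄ : σ₄ = 1 ∨ σ₄ = -1)
    (hW : ∀ k : Fin 3, (1 / 2 : ℝ) ≤ σ k * (su2Quat (wrapReps (P.1 0) k)).re) (hS : (1 / 2 : ℝ) ≤ σ₄ * (su2Quat (P.2 0)).re)
    (hsmall : 192 * (L : ℝ) ^ 2 * Real.sqrt (ringDeficit L (fun _ => false) P) < 1 / 4) :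
    ∃ u : FixVar L × Fin 3 → ℝ,
      centralProj L σ σ₄ P *
          multiCurve (dirOf (fixFrameStd (L := L)) u) (dirOf_conjTranspose fixFrameStd_conjTranspose u) (dirOf_trace fixFrameStd_trace u) 1 = P ∧
      u ⬝ᵥ u ≤ 11612160 * (L : ℝ) ^ 8 * ringDeficit L (fun _ => false) P := by
  have ht : treeGauge (P.1 0) = 1 := treeGauge_eq_one_of_tree_links hP
  have hF0 : 0 ≤ ringDeficit L (fun _ => false) P := ringDeficit_nonneg _ P
  have hδ0 : 0 ≤ Real.sqrt (ringDeficit L (fun _ => false) P) := Real.sqrt_nonneg _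
  have hL0 : (0 : ℝ) ≤ L := Nat.cast_nonneg _
  set C : (Fin (2 * L - 1 + 1) → GaugeConfig 3 L SU2) × (Site 3 L → SU2) := centralProj L σ σ₄ P with hC
  -- the slots of `P` are `1/4`-close to those of `C`
  have hnear1 : ∀ (i : Fin (2 * L - 1 + 1)) (e : Edge 3 L),
      ‖(P.1 i e : Matrix (Fin 2) (Fin 2) ℂ) - (C.1 i e : Matrix (Fin 2) (Fin 2) ℂ)‖ < 1 / 4 := fun i e => by
    rw [norm_coe_sub_coe_eq_fd, fd_comm]
    exact (fd_slice_centralProj_le P ht hσ σ₄ hW i e).trans_lt hsmall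
  have hnear2 : ∀ x : Site 3 L, ‖(P.2 x : Matrix (Fin 2) (Fin 2) ℂ) - (C.2 x : Matrix (Fin 2) (Fin 2) ℂ)‖ < 1 / 4 := fun x => by
    rw [norm_coe_sub_coe_eq_fd, fd_comm]
    refine (fd_seam_centralProj_le P ht σ hσ₄ hS x).trans_lt (lt_of_le_of_lt ?_ hsmall)
    nlinarith [mul_nonneg (pow_nonneg hL0 2) hδ0]
  obtain ⟨Y, hY, hY0, hCP, hY1, hY2⟩ := exists_multiCurve_eq_of_near C P hnear1 hnear2
  -- `Y` vanishes on the tree links of slice `0`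
  have hYtree : ∀ e : Edge 3 L, treeEdge e = true → Y (Sum.inl (0, e)) = 0 := fun e he => by
    have h := hY1 0 e
    have hCe : C.1 0 e = 1 := by
      show combFlat (fun k => centralRep (σ k) (blockIm L (wrapBlock L k) k P)) e = 1
      rw [combFlat_apply, if_neg (fun h => not_treeEdge_of_wrap h he)]
    rw [hCe, hP e he, sub_self, norm_zero, mul_zero] at h
    exact norm_le_zero_iff.1 h
  refine ⟨fixCoord Y, ?_, ?_⟩
  · rw [multiCurve_congr _ _ hY hY0 (dirOf_fixFrameStd_fixCoord hY hY0 hYtree) 1]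
    exact hCP
  · -- `|u|² ≤ 12·Σ‖Y_w‖² ≤ 12·16·Σ‖q − q'‖²`
    have hY1' : ∀ (i : Fin (2 * L - 1 + 1)) (e : Edge 3 L), ‖Y (Sum.inl (i, e))‖ ^ 2 ≤ 16 * ‖su2Quat (P.1 i e) - su2Quat (C.1 i e)‖ ^ 2 :=
      fun i e => by
      have h := hY1 i e
      rw [norm_coe_sub_coe_eq_fd, fd_comm] at h
      have h2 : ‖Y (Sum.inl (i, e))‖ ≤ 4 * ‖su2Quat (P.1 i e) - su2Quat (C.1 i e)‖ :=
        h.trans (by linarith [fd_le_two_mul_norm_su2Quat_sub (P.1 i e) (C.1 i e)])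
      calc ‖Y (Sum.inl (i, e))‖ ^ 2 ≤ (4 * ‖su2Quat (P.1 i e) - su2Quat (C.1 i e)‖) ^ 2 := pow_le_pow_left₀ (norm_nonneg _) h2 2
        _ = 16 * ‖su2Quat (P.1 i e) - su2Quat (C.1 i e)‖ ^ 2 := by ring
    have hY2' : ∀ x : Site 3 L, ‖Y (Sum.inr x)‖ ^ 2 ≤ 16 * ‖su2Quat (P.2 x) - su2Quat (C.2 x)‖ ^ 2 := fun x => by
      have h := hY2 x
      rw [norm_coe_sub_coe_eq_fd, fd_comm] at h
      have h2 : ‖Y (Sum.inr x)‖ ≤ 4 * ‖su2Quat (P.2 x) - su2Quat (C.2 x)‖ :=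
        h.trans (by linarith [fd_le_two_mul_norm_su2Quat_sub (P.2 x) (C.2 x)])
      calc ‖Y (Sum.inr x)‖ ^ 2 ≤ (4 * ‖su2Quat (P.2 x) - su2Quat (C.2 x)‖) ^ 2 := pow_le_pow_left₀ (norm_nonneg _) h2 2
        _ = 16 * ‖su2Quat (P.2 x) - su2Quat (C.2 x)‖ ^ 2 := by ring
    have hsum := sum_norm_sq_sub_centralProj_le P ht hσ hσ₄ hW hS
    have hA : (∑ i : Fin (2 * L - 1 + 1), ∑ e : Edge 3 L, ‖Y (Sum.inl (i, e))‖ ^ 2) ≤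
        16 * ∑ i : Fin (2 * L - 1 + 1), ∑ e : Edge 3 L, ‖su2Quat (P.1 i e) - su2Quat (C.1 i e)‖ ^ 2 := by
      rw [Finset.mul_sum]
      refine Finset.sum_le_sum fun i _ => ?_
      rw [Finset.mul_sum]
      exact Finset.sum_le_sum fun e _ => hY1' i e
    have hB : ∑ x : Site 3 L, ‖Y (Sum.inr x)‖ ^ 2 ≤ 16 * ∑ x : Site 3 L, ‖su2Quat (P.2 x) - su2Quat (C.2 x)‖ ^ 2 := by
      rw [Finset.mul_sum]
      exact Finset.sum_le_sum fun x _ => hY2' x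
    have hsplit : ∑ w : ((Fin (2 * L - 1 + 1) × Edge 3 L) ⊕ Site 3 L), ‖Y w‖ ^ 2 =
        (∑ i : Fin (2 * L - 1 + 1), ∑ e : Edge 3 L, ‖Y (Sum.inl (i, e))‖ ^ 2) + ∑ x : Site 3 L, ‖Y (Sum.inr x)‖ ^ 2 := by
      rw [Fintype.sum_sum_type, Fintype.sum_prod_type]
    have hu := fixCoord_dot_self_le (L := L) Y
    rw [hsplit] at hu
    calc fixCoord (L := L) Y ⬝ᵥ fixCoord (L := L) Y
        ≤ 12 * ((∑ i : Fin (2 * L - 1 + 1), ∑ e : Edge 3 L, ‖Y (Sum.inl (i, e))‖ ^ 2) + ∑ x : Site 3 L, ‖Y (Sum.inr x)‖ ^ 2) := hu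
      _ ≤ 12 * (16 * ((∑ i : Fin (2 * L - 1 + 1), ∑ e : Edge 3 L, ‖su2Quat (P.1 i e) - su2Quat (C.1 i e)‖ ^ 2) +
            ∑ x : Site 3 L, ‖su2Quat (P.2 x) - su2Quat (C.2 x)‖ ^ 2)) := by linarith [hA, hB]
      _ ≤ 12 * (16 * (60480 * (L : ℝ) ^ 8 * ringDeficit L (fun _ => false) P)) := by linarith [hsum]
      _ = 11612160 * (L : ℝ) ^ 8 * ringDeficit L (fun _ => false) P := by ring

end Summit.QuantumFields.YangMills.Theorems.VirialFluxGap.CentralCoercivity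

end
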